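import Summits.MatrixMultiplication.MatrixMultiplication.Theorems.FarEdgeDescentCouplingBridge
import HarnessLib

/-!
# The symmetric cover, part 1: the coherent special fibre of the twisted star and the
# integer covering certificate `K^{4×4} = 𝐒 + P·𝐒` (`𝐒 = Sym₂ ⊗ Sym₂`)

Route `FarEdgeDescent` (decomposition cell `decomp-mm`, lens 2 «structural dichotomy: special vs
generic», gen 30), support for the aside `SubLogRate` (stmt-MatrixMultiplication-25371); written for
the question left open by Kernels II/IV of this lineage (`twistedStar_pow_incomparable`,
`coupling₁_pow_incomparable`: in NO Kronecker power is `⟨n,n,2L⟩^{⊠N}` a degeneration of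
`𝔖_n(L)^{⊠N}` — so how many helper copies does the transpose cost?) and for the sister lens 4
(`Theses/OutsiderSandwich.lean`, stub «`⟨B⟩ ⊠ C₁^{⊠N} ⊵ ⟨2,2,2⟩^{⊠N}` with `B ≤ 2^{εN}`»; census
rows I54/I59 had `B(2) = 2` by an exact linear solve over `ℚ`).

The twisted star `𝔖_n(L)` is the tensor of `(X; Y, Y') ↦ (XY, XᵀY')` (`twistedStar`); lens 4's
coupled Coppersmith–Winograd block `C₁` is `𝔖₂(1)` with rotated legs (`FarEdgeDescentCouplingBridge`).
The dichotomy of this file is between the SPECIAL fibre of the `x`-slot and its GENERIC complement: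

* **Special fibre (all `n, L`).**  For any swap-invariant quotient `u` of the index set of `X`
  (`u (i,j) = u (j,i)`), substituting `x_{ij} := s_{u(i,j)}` makes BOTH leaves of `𝔖_n(L)` read the
  same symmetric-type matrix: `𝔖_n(L) ≥ symStar n L u` (`twistedStar_restrictsTo_symStar`), the
  tensor of `(S; Y, Y') ↦ (SY, SY')` — on the twist-fixed quotient the twist is invisible, in every
  Kronecker power (restriction is multiplicative).
* **Generic complement (`n = 2`, second power).**  `K^{4×4} = 𝐒 + P·𝐒`, where
  `𝐒 = Sym₂ ⊗ Sym₂` (the `9`-dimensional fixed space of both partial transposes: symmetric `4×4`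
  matrices with `M₁₄ = M₂₃`) and `P` is the permutation of the rows `(i,i') ↦ (i', i+1)` (the
  `4`-cycle `00 → 01 → 11 → 10`); the decomposition `M = S₁(M) + P·S₂(M)` has an explicit integer
  certificate (`coefOne`, `coefTwo`, checked by `decide` in `cover_identity`).  No product translate
  `(g₁ ⊗ g₂)·𝐒·(h₁ ⊗ h₂)` can replace `P` (its image in `K^{4×4}/𝐒 ≅ K⁷` has dimension `≤ 5`), so
  the covering translate is necessarily entangled across the two Kronecker factors.

This part (≤ 400 lines; part 2 `FarEdgeDescentSymmetricCover` imports it, same namespace) contains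
three general restriction patterns (`tensorRestrictsTo_midLinear`, `tensorRestrictsTo_directSum_glue`,
`unitTwo_kronecker_restrictsTo_directSum_self`, `kroneckerPow_two_restrictsTo_kronecker`), the
special fibre `twistedStar_restrictsTo_symStar` (all `n, L, u`), the certificate `cover_identity`
and the generic cover `ssMatMul_cover` — `(𝐒-matrix × K^{4×C}) ⊕ (𝐒-matrix × K^{4×C}) ≥ ⟨4,4,C⟩`
over every commutative ring.  Part 2 assembles `⟨2⟩ ⊠ 𝔖₂(1)^{⊠2} ≥ ⟨2,2,2⟩^{⊠2}` and, over `ℂ`,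
`⟨2⟩ ⊠ C₁^{⊠2} ≥ ⟨2,2,2⟩^{⊠2}` (helper count exactly `2` at `N = 2`).  No `sorry`.

## References

* D. Coppersmith, S. Winograd, *Matrix multiplication via arithmetic progressions*, J. Symb. Comp. 9
  (1990), §7 (the coupled blocks of `CW^{⊗2}`). [CoppersmithWinograd1990]
* M. Bläser, *Fast Matrix Multiplication*, Theory of Computing Graduate Surveys 5 (2013), Def. 7.2
  (restrictions by substitution), Lemma 5.5, §5 (the tensor `⟨k,m,n⟩`). [Blaser2013]
* P. Bürgisser, M. Clausen, M. A. Shokrollahi, *Algebraic Complexity Theory* (1997), (14.28),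
  (15.19)–(15.25) (restriction preorder, direct sums, Kronecker products). [BurgisserClausenShokrollahi1997]
* M. Christandl, P. Vrana, J. Zuiddam, *Universal points in the asymptotic spectrum of tensors*,
  J. AMS 36 (2023), §1.1–1.2. [ChristandlVranaZuiddam2023]
-/

noncomputable section

open scoped BigOperators

set_option linter.dupNamespace false
namespace Summit.MatrixMultiplication.MatrixMultiplication.Theorems.FarEdgeDescentSymmetricCover

open Literature.Computability.AlgebraicComplexity
  Summit.MatrixMultiplication.MatrixMultiplication.Theorems.FarEdgeDescentTwistedStar
  Summit.MatrixMultiplication.MatrixMultiplication.Theorems.FarEdgeDescentCouplingBridge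
  Summit.MatrixMultiplication.MatrixMultiplication.Theorems.OutsiderSandwichCoupling
  Summit.MatrixMultiplication.MatrixMultiplication.Theorems.OutsiderSandwichBlockNormalForm

universe u

/-! ## 1. Three restriction patterns -/

section Patterns

variable {K : Type u} [CommSemiring K]
variable {ι κ μ ι' κ' μ' ι₁ κ₁ μ₁ : Type*}

/-- Collapsing a triple sum against three Kronecker deltas. [folklore] -/
private theorem sum_delta₃ [Fintype ι] [Fintype κ] [Fintype μ] [DecidableEq ι] [DecidableEq κ]
    [DecidableEq μ] (t : ι → κ → μ → K) (a₀ : ι) (b₀ : κ) (c₀ : μ) :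
    (∑ a, ∑ b, ∑ c, (if a₀ = a then (1 : K) else 0) * (if b₀ = b then (1 : K) else 0) *
      (if c₀ = c then (1 : K) else 0) * t a b c) = t a₀ b₀ c₀ := by
  rw [Finset.sum_eq_single a₀ (fun a _ ha => by simp [Ne.symm ha]) (by simp),
    Finset.sum_eq_single b₀ (fun b _ hb => by simp [Ne.symm hb]) (by simp),
    Finset.sum_eq_single c₀ (fun c _ hc => by simp [Ne.symm hc]) (by simp)]
  simp

/-- **Substitution with a linear map in the middle slot and index maps outside is a
restriction**: `t ≥ (∑_b B b' b · t (f a') b (h c'))_{a',b',c'}` (matrices `A = f^*`, `B`, `C = h^*`;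
Bläser 2013, Def. 7.2 / BCS (14.28)). [cite: Blaser2013, Def. 7.2] -/
theorem tensorRestrictsTo_midLinear [Fintype ι] [Fintype κ] [Fintype μ] [DecidableEq ι]
    [DecidableEq μ] (t : ι → κ → μ → K) (f : ι' → ι) (B : κ' → κ → K) (h : μ' → μ) :
    TensorRestrictsTo t (fun a b c => ∑ b₀, B b b₀ * t (f a) b₀ (h c)) := by
  refine ⟨fun a' a => if f a' = a then 1 else 0, B, fun c' c => if h c' = c then 1 else 0,
    fun a' b' c' => ?_⟩
  have key : (∑ a, ∑ b, ∑ c, (if f a' = a then (1 : K) else 0) * B b' b *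
      (if h c' = c then (1 : K) else 0) * t a b c) = ∑ b, B b' b * t (f a') b (h c') := by
    rw [Finset.sum_eq_single (f a') (fun a _ ha => by simp [Ne.symm ha]) (by simp)]
    refine Finset.sum_congr rfl fun b _ => ?_
    rw [Finset.sum_eq_single (h c') (fun c _ hc => by simp [Ne.symm hc]) (by simp)]
    simp
  exact key.symm

/-- Mixed block `(inl, inl, inr)` of a direct sum vanishes. [folklore] -/
@[simp] private theorem directSumTensor_inl_inl_inr (s : ι → κ → μ → K) (t : ι₁ → κ₁ → μ₁ → K)
    (a : ι) (b : κ) (c : μ₁) : directSumTensor s t (Sum.inl a) (Sum.inl b) (Sum.inr c) = 0 := rfl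

/-- Mixed block `(inr, inr, inl)` of a direct sum vanishes. [folklore] -/
@[simp] private theorem directSumTensor_inr_inr_inl (s : ι → κ → μ → K) (t : ι₁ → κ₁ → μ₁ → K)
    (a : ι₁) (b : κ₁) (c : μ) : directSumTensor s t (Sum.inr a) (Sum.inr b) (Sum.inl c) = 0 := rfl

/-- **Gluing is a restriction of the direct sum**: identifying variables of `t` and `t'` in all
three slots along index maps gives `t ⊕ t' ≥ (t (f a) (g b) (h c) + t' (f' a) (g' b) (h' c))_{a,b,c}`
(matrices `A = f^* + f'^*` etc.; the x-shared star principle of `FarEdgeDescentTwistedStarCore`,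
`tensorRestrictsTo_precomp_add`, on all slots at once).  [cite: Blaser2013, Def. 7.2] -/
theorem tensorRestrictsTo_directSum_glue [Fintype ι] [Fintype κ] [Fintype μ] [Fintype ι₁]
    [Fintype κ₁] [Fintype μ₁] [DecidableEq ι] [DecidableEq κ] [DecidableEq μ] [DecidableEq ι₁]
    [DecidableEq κ₁] [DecidableEq μ₁] (t : ι → κ → μ → K) (t' : ι₁ → κ₁ → μ₁ → K) (f : ι' → ι)
    (g : κ' → κ) (h : μ' → μ) (f' : ι' → ι₁) (g' : κ' → κ₁) (h' : μ' → μ₁) :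
    TensorRestrictsTo (directSumTensor t t')
      (fun a b c => t (f a) (g b) (h c) + t' (f' a) (g' b) (h' c)) := by
  refine ⟨fun a' => Sum.elim (fun a => if f a' = a then 1 else 0) (fun a => if f' a' = a then 1 else 0),
    fun b' => Sum.elim (fun b => if g b' = b then 1 else 0) (fun b => if g' b' = b then 1 else 0),
    fun c' => Sum.elim (fun c => if h c' = c then 1 else 0) (fun c => if h' c' = c then 1 else 0),
    fun a' b' c' => ?_⟩
  simp only [Fintype.sum_sum_type, Sum.elim_inl, Sum.elim_inr, directSumTensor_inl,
    directSumTensor_inr, directSumTensor_inl_inr, directSumTensor_inr_inl,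
    directSumTensor_inl_inl_inr, directSumTensor_inr_inr_inl, mul_zero, Finset.sum_const_zero,
    add_zero, zero_add]
  rw [sum_delta₃, sum_delta₃]

/-- `⟨2⟩ ⊠ X ≥ X ⊕ X` (the relabelling `I ⊕ I ≃ Fin 2 × I`; converse direction of the tree's
`tensorRestrictsTo_directSum_self_unit_two`). [cite: Blaser2013, Def. 7.2] -/
theorem unitTwo_kronecker_restrictsTo_directSum_self [Fintype ι] [Fintype κ] [Fintype μ]
    [DecidableEq ι] [DecidableEq κ] [DecidableEq μ] (X : ι → κ → μ → K) :
    TensorRestrictsTo (kroneckerTensor (unitTensor K 2) X) (directSumTensor X X) := by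
  have e : directSumTensor X X = fun x y z => kroneckerTensor (unitTensor K 2) X
      (Sum.elim (fun a => ((0 : Fin 2), a)) (fun a => ((1 : Fin 2), a)) x)
      (Sum.elim (fun b => ((0 : Fin 2), b)) (fun b => ((1 : Fin 2), b)) y)
      (Sum.elim (fun c => ((0 : Fin 2), c)) (fun c => ((1 : Fin 2), c)) z) := by
    funext x y z
    rcases x with a | a <;> rcases y with b | b <;> rcases z with c | c <;>
      simp [directSumTensor, kroneckerTensor_apply, unitTensor_apply]
  rw [e]
  exact tensorRestrictsTo_precomp _ _ _ _

/-- `t^{⊠2} ≥ t ⊠ t` (the relabelling `I × I ≃ (Fin 2 → I)`). [cite: ChristandlVranaZuiddam2023, §1.1] -/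
theorem kroneckerPow_two_restrictsTo_kronecker [Fintype ι] [Fintype κ] [Fintype μ] [DecidableEq ι]
    [DecidableEq κ] [DecidableEq μ] (t : ι → κ → μ → K) :
    TensorRestrictsTo (kroneckerPow t 2) (kroneckerTensor t t) := by
  have e : kroneckerTensor t t = fun x y z =>
      kroneckerPow t 2 ![x.1, x.2] ![y.1, y.2] ![z.1, z.2] := by
    funext x y z
    simp [kroneckerPow_apply, Fin.prod_univ_two]
  rw [e]
  exact tensorRestrictsTo_precomp _ _ _ _

/-- Transferring an indicator along an equivalence of its condition. [folklore] -/
theorem ite_one_zero_congr {P Q : Prop} [Decidable P] [Decidable Q] (hPQ : P ↔ Q) :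
    (if P then (1 : K) else 0) = if Q then 1 else 0 := by
  by_cases hP : P
  · rw [if_pos hP, if_pos (hPQ.1 hP)]
  · rw [if_neg hP, if_neg (fun hQ => hP (hPQ.2 hQ))]

end Patterns

/-! ## 2. The special fibre: on a swap-invariant quotient of the `x`-index both leaves are coherent -/

section SpecialFibre

variable (K : Type u) [CommSemiring K]

/-- **The symmetrised star** `symStar n L u` for a quotient map `u` of `Fin n × Fin n`: slots as for
`twistedStar` (`Z ⊕ Z'`; the quotient index `p`; `Y ⊕ Y'`), entry `1` iff the leaf blocks agree,
`u (row of Z-variable, row of Y-variable) = p` and the inner (column) indices agree.  For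
`u = (i,j) ↦ {i,j}` it is the tensor of `(S; Y, Y') ↦ (SY, SY')`, `S` a symmetric `n × n` matrix.
[cite: Blaser2013, §5 (the tensor ⟨k,m,n⟩)] -/
def symStar (n L : ℕ) {P : Type*} [DecidableEq P] (u : Fin n × Fin n → P) :
    (Fin n × Fin L) ⊕ (Fin n × Fin L) → P → (Fin n × Fin L) ⊕ (Fin n × Fin L) → K
  | Sum.inl a, p, Sum.inl c => if u (a.1, c.1) = p ∧ a.2 = c.2 then 1 else 0
  | Sum.inr a, p, Sum.inr c => if u (a.1, c.1) = p ∧ a.2 = c.2 then 1 else 0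
  | _, _, _ => 0

variable {K}

/-- Block `(inl, inl)` of `symStar` (definitional unfolding). [folklore] -/
@[simp] theorem symStar_inl_inl (n L : ℕ) {P : Type*} [DecidableEq P] (u : Fin n × Fin n → P)
    (a : Fin n × Fin L) (p : P) (c : Fin n × Fin L) :
    symStar K n L u (Sum.inl a) p (Sum.inl c) = if u (a.1, c.1) = p ∧ a.2 = c.2 then 1 else 0 :=
  rfl

/-- Block `(inr, inr)` of `symStar` (definitional unfolding). [folklore] -/
@[simp] theorem symStar_inr_inr (n L : ℕ) {P : Type*} [DecidableEq P] (u : Fin n × Fin n → P)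
    (a : Fin n × Fin L) (p : P) (c : Fin n × Fin L) :
    symStar K n L u (Sum.inr a) p (Sum.inr c) = if u (a.1, c.1) = p ∧ a.2 = c.2 then 1 else 0 :=
  rfl

/-- Mixed block `(inl, inr)` of `symStar` vanishes (definitional unfolding). [folklore] -/
@[simp] theorem symStar_inl_inr (n L : ℕ) {P : Type*} [DecidableEq P] (u : Fin n × Fin n → P)
    (a : Fin n × Fin L) (p : P) (c : Fin n × Fin L) :
    symStar K n L u (Sum.inl a) p (Sum.inr c) = 0 :=
  rfl

/-- Mixed block `(inr, inl)` of `symStar` vanishes (definitional unfolding). [folklore] -/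
@[simp] theorem symStar_inr_inl (n L : ℕ) {P : Type*} [DecidableEq P] (u : Fin n × Fin n → P)
    (a : Fin n × Fin L) (p : P) (c : Fin n × Fin L) :
    symStar K n L u (Sum.inr a) p (Sum.inl c) = 0 :=
  rfl

/-- **The special fibre is coherent** (all `n, L`, every swap-invariant quotient `u`):
`𝔖_n(L) ≥ symStar n L u` — substituting `x_{ij} := s_{u(i,j)}` (the `0/1` matrix `B p (i,j) =
[u(i,j) = p]` in the middle slot), the coherent leaf reads `S` and the twisted leaf reads `Sᵀ = S`.
On the twist-fixed quotient of the `x`-slot the twist is invisible. [cite: Blaser2013, Def. 7.2] -/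
theorem twistedStar_restrictsTo_symStar (n L : ℕ) {P : Type*} [Fintype P] [DecidableEq P]
    (u : Fin n × Fin n → P) (hu : ∀ i j, u (i, j) = u (j, i)) :
    TensorRestrictsTo (twistedStar K n L) (symStar K n L u) := by
  -- landed-duplicate guard (lander): the folklore unfolding lemma as a local hypothesis, `rfl`
  have mm : ∀ (a : Fin n × Fin L) (b : Fin n × Fin n) (c : Fin n × Fin L),
      matMulTensor K n n L a b c = if a.1 = b.1 ∧ b.2 = c.1 ∧ a.2 = c.2 then 1 else 0 :=
    fun _ _ _ => rfl
  have e : symStar K n L u = fun a p c =>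
      ∑ b, (if u b = p then (1 : K) else 0) * twistedStar K n L (id a) b (id c) := by
    funext a p c
    rcases a with ⟨i, m⟩ | ⟨i, m⟩ <;> rcases c with ⟨j, m'⟩ | ⟨j, m'⟩
    · simp only [symStar_inl_inl, id, twistedStar_inl_inl, mm]
      rw [Finset.sum_eq_single (i, j) ?_ (by simp)]
      · by_cases hp : u (i, j) = p <;> by_cases hm : m = m' <;> simp [hp, hm]
      · rintro ⟨b₁, b₂⟩ - hb
        have hne : ¬ (i = b₁ ∧ b₂ = j ∧ m = m') := by
          rintro ⟨rfl, rfl, -⟩; exact hb rfl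
        simp [hne]
    · simp [id]
    · simp [id]
    · simp only [symStar_inr_inr, id, twistedStar_inr_inr, mm, Prod.fst_swap, Prod.snd_swap]
      rw [Finset.sum_eq_single (j, i) ?_ (by simp)]
      · by_cases hp : u (i, j) = p <;> by_cases hm : m = m' <;> simp [hp, hm, hu j i]
      · rintro ⟨b₁, b₂⟩ - hb
        have hne : ¬ (i = b₂ ∧ b₁ = j ∧ m = m') := by
          rintro ⟨rfl, rfl, -⟩; exact hb rfl
        simp [hne]
  rw [e]
  exact tensorRestrictsTo_midLinear _ _ _ _

end SpecialFibre

/-! ## 3. The generic cover for `n = 2`: `K^{4×4} = 𝐒 + P·𝐒`, `𝐒 = Sym₂ ⊗ Sym₂` -/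

section Cover

/-- Row (and column) indices of `K^{4×4} = K^{2×2} ⊗ K^{2×2}`: bit pairs `(i, i')`. [folklore] -/
abbrev Row : Type := Fin 2 × Fin 2

/-- The unordered class of a pair of bits, encoded by its weight `i + j ∈ {0,1,2}`. [folklore] -/
def wt (b : Fin 2 × Fin 2) : Fin 3 := ⟨(b.1 : ℕ) + (b.2 : ℕ), by omega⟩

/-- `wt` is swap-invariant. [folklore] -/
theorem wt_symm (i j : Fin 2) : wt (i, j) = wt (j, i) := by
  simp [wt, add_comm]

/-- The `𝐒`-coordinate of the entry `(r, k)` of a `4 × 4` matrix (`r = (i,i')`, `k = (j,j')`):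
`({i,j}, {i',j'})`, i.e. the pair of weights; `𝐒 = Sym₂ ⊗ Sym₂` is exactly the space of matrices
whose entries are constant on the fibres of `ssCoord`. [folklore] -/
def ssCoord (r k : Row) : Fin 3 × Fin 3 := (wt (r.1, k.1), wt (r.2, k.2))

/-- The covering permutation of the rows: the `4`-cycle `(i,i') ↦ (i', i+1)`, i.e.
`00 → 01 → 11 → 10 → 00`. [folklore] -/
def rot (r : Row) : Row := (r.2, r.1 + 1)

/-- Kronecker delta on matrix positions, as an integer. [folklore] -/
def dlt (b c : Row × Row) : ℤ := if b = c then 1 else 0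

/-- **The certificate, second summand**: the coefficient of the matrix entry `M_b` (`b = (r', k')`)
in the `𝐒`-coordinate `p` of `S₂(M)`, where `M = S₁(M) + P·S₂(M)`:
`s₀₀ = M_{10,00} − M_{00,10}`, `s₀₁ = M_{10,01} − M_{11,00}`, `s₀₂ = M_{00,01} − M_{01,00}`,
`s₁₂ = M_{00,11} − M_{11,00}`, `s₂₀ = M_{11,10} − M_{10,11}`, `s₂₁ = M_{01,10} − M_{11,00}`,
`s₂₂ = M_{01,11} − M_{11,01}`, `s₁₀ = s₁₁ = 0` (solved by hand from the seven linear conditions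
"`M − P·S₂(M)` is symmetric with equal `(00,11)` and `(01,10)` entries"). [folklore] -/
def coefTwo (b : Row × Row) (p : Fin 3 × Fin 3) : ℤ :=
  if p = (0, 0) then dlt b ((1, 0), (0, 0)) - dlt b ((0, 0), (1, 0)) else
  if p = (0, 1) then dlt b ((1, 0), (0, 1)) - dlt b ((1, 1), (0, 0)) else
  if p = (0, 2) then dlt b ((0, 0), (0, 1)) - dlt b ((0, 1), (0, 0)) else
  if p = (1, 2) then dlt b ((0, 0), (1, 1)) - dlt b ((1, 1), (0, 0)) else
  if p = (2, 0) then dlt b ((1, 1), (1, 0)) - dlt b ((1, 0), (1, 1)) else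
  if p = (2, 1) then dlt b ((0, 1), (1, 0)) - dlt b ((1, 1), (0, 0)) else
  if p = (2, 2) then dlt b ((0, 1), (1, 1)) - dlt b ((1, 1), (0, 1)) else 0

/-- A bit pair of prescribed weight. [folklore] -/
def rep (w : Fin 3) : Fin 2 × Fin 2 := if w = 0 then (0, 0) else if w = 1 then (0, 1) else (1, 1)

/-- A matrix position of prescribed `𝐒`-coordinate. [folklore] -/
def repPair (p : Fin 3 × Fin 3) : Row × Row := (((rep p.1).1, (rep p.2).1), ((rep p.1).2, (rep p.2).2))

/-- **The certificate, first summand**: the coefficient of `M_b` in the `𝐒`-coordinate `p` of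
`S₁(M) = M − P·S₂(M)` (read off at the representative position of `p`). [folklore] -/
def coefOne (b : Row × Row) (p : Fin 3 × Fin 3) : ℤ :=
  dlt b (repPair p) - coefTwo b (ssCoord (rot (repPair p).1) (repPair p).2)

/-- **The covering identity** `M = S₁(M) + P·S₂(M)` with `S₁(M), S₂(M) ∈ 𝐒`, entrywise and as an
identity of integer coefficient tables: for every position `(r, k)` and every entry `M_b`,
`[b = (r,k)] = coefOne b (ssCoord r k) + coefTwo b (ssCoord (rot r) k)` — in particular the
right-hand side depends on `(r, k)` only through the `𝐒`-coordinates, which is the membership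
`S₁(M), S₂(M) ∈ 𝐒`.  Checked by `decide` (`256` integer identities). [folklore] -/
theorem cover_identity : ∀ (r k : Row) (b : Row × Row),
    (if r = b.1 ∧ b.2 = k then (1 : ℤ) else 0) = coefOne b (ssCoord r k) + coefTwo b (ssCoord (rot r) k) := by
  decide

variable (K : Type u) [CommRing K]

/-- `⟨4,4,C⟩` with an `𝐒`-matrix: the tensor of `(S, Y) ↦ SY`, `S ∈ 𝐒 = Sym₂ ⊗ Sym₂` given by its
nine coordinates `p ∈ Fin 3 × Fin 3`, `Y ∈ K^{4×C}` (slots `Z`; `S`; `Y`). [folklore] -/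
def ssMatMul (C : Type*) [DecidableEq C] : Row × C → Fin 3 × Fin 3 → Row × C → K :=
  fun a p c => if ssCoord a.1 c.1 = p ∧ a.2 = c.2 then 1 else 0

/-- `⟨4,4,C⟩` with rows and columns of the matrix indexed by bit pairs (slots `Z`; `M`; `Y`).
[cite: Blaser2013, §5 (the tensor ⟨k,m,n⟩)] -/
def rowMatMul (C : Type*) [DecidableEq C] : Row × C → Row × Row → Row × C → K :=
  fun a b c => if a.1 = b.1 ∧ b.2 = c.1 ∧ a.2 = c.2 then 1 else 0

variable {K}

/-- **The generic cover**: `(𝐒 × K^{4×C}) ⊕ (𝐒 × K^{4×C}) ≥ ⟨4,4,C⟩` — feed `S₁(M)` to the first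
copy and `S₂(M)` to the second, the same `Y` to both, and read `MY = S₁(M)Y + P·(S₂(M)Y)`.
[cite: BurgisserClausenShokrollahi1997, (14.28)] -/
theorem ssMatMul_cover (C : Type*) [Fintype C] [DecidableEq C] :
    TensorRestrictsTo (directSumTensor (ssMatMul K C) (ssMatMul K C)) (rowMatMul K C) := by
  set T₁ : Row × C → Row × Row → Row × C → K :=
    fun a b c => ∑ p, ((coefOne b p : ℤ) : K) * ssMatMul K C (id a) p (id c) with hT₁
  set T₂ : Row × C → Row × Row → Row × C → K :=
    fun a b c => ∑ p, ((coefTwo b p : ℤ) : K) * ssMatMul K C (rot a.1, a.2) p (id c) with hT₂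
  have h₁ : TensorRestrictsTo (directSumTensor (ssMatMul K C) (ssMatMul K C)) (directSumTensor T₁ T₂) :=
    (tensorRestrictsTo_midLinear (ssMatMul K C) id (fun b p => ((coefOne b p : ℤ) : K)) id).directSum
      (tensorRestrictsTo_midLinear (ssMatMul K C) (fun a : Row × C => (rot a.1, a.2))
        (fun b p => ((coefTwo b p : ℤ) : K)) id)
  have h₂ : TensorRestrictsTo (directSumTensor T₁ T₂)
      (fun a b c => T₁ (id a) (id b) (id c) + T₂ (id a) (id b) (id c)) :=
    tensorRestrictsTo_directSum_glue T₁ T₂ id id id id id id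
  have e : rowMatMul K C = fun a b c => T₁ (id a) (id b) (id c) + T₂ (id a) (id b) (id c) := by
    funext a b c
    simp only [hT₁, hT₂, id, ssMatMul, rowMatMul]
    by_cases hc : a.2 = c.2
    · have key := congrArg (Int.cast : ℤ → K) (cover_identity a.1 c.1 b)
      push_cast at key
      simp only [hc, and_true, mul_ite, mul_one, mul_zero, Finset.sum_ite_eq, Finset.mem_univ,
        if_true]
      exact key
    · simp [hc]
  rw [e]
  exact h₁.trans h₂

end Cover

end Summit.MatrixMultiplication.MatrixMultiplication.Theorems.FarEdgeDescentSymmetricCover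

end
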